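import Literature.MathematicalPhysics.QuantumFieldTheory.Balaban1983to89.B7Eq92ConcreteRec
import Literature.MathematicalPhysics.QuantumFieldTheory.Balaban1983to89.B7Eq99Concrete

/-!
# `Balaban1983to89.B7Eq99ConcreteRec` — [Balaban1985Averaging] Sect. D (78), (85), (92)⇒(99)∕(100), (87)⇒(88) pp. 30–32 FOR THE RECORD's AVERAGING STRUCTURE ([Balaban1987RG1] (0.3)–(0.4)):
# the site average (78) `savgZ`, the rotated block average `R0avgZ`, the frame recursion (85) `wrecZ`, and THE IDENTITY (99) `W_j = v_j` for the record twins — exact identities,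
# proofs re-run from the engine's `B7Eq99Concrete`

statement-level skeleton of published theorems with citation tags; proofs where landed; nothing here is a claim about the Yang–Mills mass gap

CITATION HEADER (lean-in-tree rule).  Cell `pub-ymgap`, seat `pub-ymgap-dag-n05-e` g35 (N05-REC LEAD PEN); item R1 ([3] layer) of the road — the Sect. D IDENTITIES around (99) that the cell's R2 (`B8Eq115GaugeFixingRec`,
n05-d) and R4∕R5 wait for.  `--kind proof --supports stmt-QuantumFields-20541` (K0⁷; count-neutral; no definition).  Sources READ: [3] pp. 27–32 (`paper:balaban1985-cmp98-averaging`) through the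
engine module `B7Eq99Concrete`, whose §2–§3 proofs are re-run token for token over the record objects (TOKEN RULE: `bavg ↦ bavgZ`, `avgIter ↦ avgIterZ`, block points `y + boxVec L r ↦ y + offZ L r`,
the Sect. C–D objects ↦ their `…Z` twins of `B7SectCDGaugeAveragesRec`; the fundamental equality (92)∕(97) from `B7Eq92ConcreteRec.tildIterZ_eq_mgauge`).  The rotated site functions `R0fun` and the
group algebra (`Rc`, `mgauge`, `tHol`, `uLev`, `inv_mul_const_mul`, `tHol_mgauge_mul_R0fun`) are REUSED BY NAME from the engine.  The flat-background reductions (`wrec_one_left`, the `j = 1, 2`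
sanity instances against `B7Prop4Flat`) are NOT twinned here (they wait for the flat-letter layer, LOCATED-N2).
WHAT IS PROVED (sorry-free): §2 `SexpZ_apply`, `savgZ_apply`, `val_savgZ`, `SexpZ_const_mul`, ★`savgZ_const_mul` (left-invariance of (78)), ★`hb_concreteZ` (the `B7Transfer.step99` binder `hb` for
the record's site average), `savgZ_of_center_eq_one`, `savgZ_tHol` ((82)-type frame average = `wframeZ`), `val_R0avgZ` ((78) literally), `R0avgZ_one_left`, `R0avgZ_of_60`; §3 `wrecZ_succ`, `wrecZ_one`,
★★`wrecZ_eq_vcovZ` ((99): `W_j = v_j` for the record), `step100Z`, ★`eq92Z` ((92) with the frames (85)), `tildIterZ_eq_mgauge_wrecZ`, `eq88_of_87Z`, `avgIterZ_eq_of_87` ((88) from (87)).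
HONEST SCOPE.  Exact algebraic identities for OUR typed record objects; no estimate; `HThm4Rec` UNDISCHARGED; N05 ∕ N07 NOT discharged; counts unmoved (typed 28∕28 · discharged 7∕28);
one finite 𝕋⁴ programme at fixed ε — nothing continuum ∕ ℝ⁴ ∕ OS ∕ mass gap ∕ Clay.  No `def`, no `instance`, no `notation`, no `sorry`.
-/
set_option autoImplicit false

noncomputable section

open scoped BigOperators
open NormedSpace Finset

namespace Literature.MathematicalPhysics.QuantumFieldTheory.Balaban1983to89.B7Eq99ConcreteRec

open B7Prop1Explicit hiding Site
open B7Prop1Explicit renaming Site → SiteZ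
open B7Prop2Explicit (rescale rescale_apply)
open MatrixLog B7AvgGaugeCovariance
open B7Eq92Concrete (Rc Rc_apply Rc_mul Rc_inv_apply mgauge mgauge_apply mgauge_mul tHol tHol_append_true tHol_append_false tHol_mgauge mlog_Rc expUnit_conj
  frame_eq_mgauge)
open B7Eq99Concrete (R0fun R0fun_apply R0fun_self R0fun_one_left R0fun_add inv_mul_const_mul tHol_mgauge_mul_R0fun)
open BlockAveragingZd (offZ bavgZ avgIterZ avgIterZ_zero avgIterZ_succ)
open BlockAveragingZdCovariance (bavgZ_gaugeAct_units avgIterZ_gaugeAct_units)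
open B7SectCDGaugeAveragesRec (FcovZ wframeZ tildZ dbavgCovZ tildIterZ dbavgCovIterZ vcovZ SexpZ savgZ R0avgZ wrecZ wrecZ_zero tildIterZ_apply)
open B7Eq92ConcreteRec (tildZ_apply dbavgCovZ_apply tildIter_zero')

variable {d : ℕ}

/-! ## §2 The site average (78) `{g(x)}_{x∈B(y)}` for the record blocks, its left-invariance (`B7Transfer`'s `hb`), the frame average and (78) literally -/

section SiteAverage

variable {𝔸 : Type*} [NormedRing 𝔸] [NormedAlgebra ℂ 𝔸] [CompleteSpace 𝔸]

omit [CompleteSpace 𝔸] in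
/-- `SexpZ_apply`: unfolding. [cite: Balaban1985Averaging, (78) p.30] -/
theorem SexpZ_apply (L : ℕ) (g : SiteZ d → 𝔸ˣ) (y : SiteZ d) :
    SexpZ L g y = ∑ r : Fin d → Fin L, (((L : ℝ) ^ d)⁻¹) • mlog ((((g y)⁻¹ * g (y + offZ L r) : 𝔸ˣ)) : 𝔸) := rfl

/-- `savgZ_apply`: unfolding. [cite: Balaban1985Averaging, (78) p.30] -/
theorem savgZ_apply (L : ℕ) (g : SiteZ d → 𝔸ˣ) (y : SiteZ d) : savgZ L g y = g y * expUnit (SexpZ L g y) := rfl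

/-- `val_savgZ`: (78) literally, `{g(x)}_{x∈B(y)} = g(y)exp[Σ_{x∈B(y)}L^{−d} log g(y)⁻¹g(x)]` in `𝔸`. [cite: Balaban1985Averaging, (78) p.30] -/
theorem val_savgZ (L : ℕ) (g : SiteZ d → 𝔸ˣ) (y : SiteZ d) :
    (savgZ L g y : 𝔸) = (g y : 𝔸) * exp (∑ r : Fin d → Fin L, (((L : ℝ) ^ d)⁻¹) • mlog ((((g y)⁻¹ * g (y + offZ L r) : 𝔸ˣ)) : 𝔸)) := by
  rfl

omit [CompleteSpace 𝔸] in
/-- The exponent sees only the relative values `g(y)⁻¹g(x)`: `S_{a·g} = S_g` for a constant unit `a`. [cite: Balaban1985Averaging, (78) p.30] -/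
theorem SexpZ_const_mul (L : ℕ) (a : 𝔸ˣ) (g : SiteZ d → 𝔸ˣ) (y : SiteZ d) :
    SexpZ L (fun x => a * g x) y = SexpZ L g y := by
  simp only [SexpZ, inv_mul_const_mul]

/-- **LEFT-INVARIANCE of the site average (78)** — `{a·g(x)}_{x∈B(y)} = a·{g(x)}_{x∈B(y)}` for every constant unit `a`
(the property `hb` that the abstract `B7Transfer.step99` takes as a binder; here a theorem for B7's own site average).
[cite: Balaban1985Averaging, (78) p.30, (100) p.32] -/
theorem savgZ_const_mul (L : ℕ) (a : 𝔸ˣ) (g : SiteZ d → 𝔸ˣ) (y : SiteZ d) :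
    savgZ L (fun x => a * g x) y = a * savgZ L g y := by
  rw [savgZ_apply, savgZ_apply, SexpZ_const_mul, mul_assoc]

/-- `hb_concreteZ`: `savgZ L` satisfies the left-invariance binder `hb` of `B7Transfer.step99`/`sectC_induction_step`
literally. [cite: Balaban1985Averaging, (78) p.30] -/
theorem hb_concreteZ (L : ℕ) :
    ∀ (a : 𝔸ˣ) (g : SiteZ d → 𝔸ˣ) (y : SiteZ d), savgZ L (fun x => a * g x) y = a * savgZ L g y :=
  fun a g y => savgZ_const_mul L a g y

omit [CompleteSpace 𝔸] in
/-- A constant site function has exponent `0` (`log 1 = 0` for the series (21)). [cite: Balaban1985Averaging, (78) p.30, (21) p.21] -/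
@[simp] theorem SexpZ_const (L : ℕ) (a : 𝔸ˣ) (y : SiteZ d) : SexpZ L (fun _ : SiteZ d => a) y = 0 := by
  simp [SexpZ, mlog_one]

/-- The site average (78) of a constant site function is that constant: `{a}_{x∈B(y)} = a`. [cite: Balaban1985Averaging, (78) p.30] -/
@[simp] theorem savgZ_const (L : ℕ) (a : 𝔸ˣ) (y : SiteZ d) : savgZ L (fun _ : SiteZ d => a) y = a := by
  rw [savgZ_apply, SexpZ_const]
  apply Units.ext
  simp [val_expUnit]

/-- A site function that is `1` at the centre averages to `exp` of the plain `L^{−d}`-weighted sum of logarithms over the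
block. [cite: Balaban1985Averaging, (78) p.30, (82) p.30] -/
theorem savgZ_of_center_eq_one (L : ℕ) (g : SiteZ d → 𝔸ˣ) (y : SiteZ d) (hg : g y = 1) :
    savgZ L g y = expUnit (∑ r : Fin d → Fin L, (((L : ℝ) ^ d)⁻¹) • mlog ((g (y + offZ L r) : 𝔸ˣ) : 𝔸)) := by
  rw [savgZ_apply, SexpZ_apply, hg, one_mul]
  simp only [inv_one, one_mul]

/-- **(82), the block frame as a site average**: `\overline{R_{0,y}V₁} = {(R_{0,y}V₁)(Γ_{y,x})}_{x∈B(y)}` — the site average (78)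
of the transporters `x ↦ (R_{0,y}V₁)(Γ_{y,x})` (which is `1` at `x = y`) is the frame `wframe` of `B7Eq92Concrete` ((82) p. 30:
"where the expression \overline{R_{0,x₁}U₁} is defined by the last equation"). [cite: Balaban1985Averaging, (82) p.30, (85) p.31] -/
theorem savgZ_tHol (L : ℕ) (V₀ V₁ : SiteZ d → Fin d → 𝔸ˣ) (y : SiteZ d) :
    savgZ L (fun x => tHol V₀ V₁ y (treeWord (x - y))) y = wframeZ L V₀ V₁ y := by
  rw [savgZ_of_center_eq_one L _ y (by simp)]
  simp only [add_sub_cancel_left]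
  rfl

/-- `val_R0avgZ` — (78) literally: "(R̄₀v)(y) = v(y)exp[Σ_{x∈B(y)}L^{−d} log v⁻¹(y)R(V₀(Γ_{y,x}))v(x)]" (`x = y + r`).
[cite: Balaban1985Averaging, (78) p.30] -/
theorem val_R0avgZ (L : ℕ) (V₀ : SiteZ d → Fin d → 𝔸ˣ) (v : SiteZ d → 𝔸ˣ) (y : SiteZ d) :
    (R0avgZ L V₀ v y : 𝔸) = (v y : 𝔸) * exp (∑ r : Fin d → Fin L, (((L : ℝ) ^ d)⁻¹) •
      mlog ((((v y)⁻¹ * Rc (hol V₀ y (treeWord (offZ L r))) (v (y + offZ L r)) : 𝔸ˣ)) : 𝔸)) := by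
  rw [R0avgZ, val_savgZ, R0fun_self]
  simp only [R0fun_add]

/-- `R0avgZ_one_left`: at `V₀ = 1` the twisted site average is the plain one. [cite: Balaban1985Averaging, (78) p.30] -/
@[simp] theorem R0avgZ_one_left (L : ℕ) (v : SiteZ d → 𝔸ˣ) (y : SiteZ d) :
    R0avgZ L (1 : SiteZ d → Fin d → 𝔸ˣ) v y = savgZ L v y := by
  rw [R0avgZ, R0fun_one_left]

/-- **(60) ⇒ (82)**: if the gauge function `u` satisfies the axial-gauge relation (60) at the block points `x = y + r`,
`r ∈ [0, L)^d` — "(R_{0,y}v)(x) = v(y)(R_{0,y}V₁)(Γ_{y,x}), x ∈ B(y), x ≠ y" (at `x = y` it holds trivially) —, then its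
twisted site average is (82) "(R̄₀u)(x₁) = u(x₁)(\overline{R_{0,x₁}U₁})(Γ_{x₁,·}) = u(x₁)\overline{R_{0,x₁}U₁}". The relation
(60) is the HYPOTHESIS `h60` (the gauge fixing (58) that produces it is not formalised). [cite: Balaban1985Averaging, (60) p.27, (82) p.30] -/
theorem R0avgZ_of_60 (L : ℕ) (V₀ V₁ : SiteZ d → Fin d → 𝔸ˣ) (u : SiteZ d → 𝔸ˣ) (y : SiteZ d)
    (h60 : ∀ r : Fin d → Fin L, R0fun V₀ y u (y + offZ L r) = u y * tHol V₀ V₁ y (treeWord (offZ L r))) :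
    R0avgZ L V₀ u y = u y * wframeZ L V₀ V₁ y := by
  rw [R0avgZ, savgZ_apply, SexpZ_apply, R0fun_self]
  simp only [h60, inv_mul_cancel_left]
  rfl

end SiteAverage

/-! ## §3 The block averages (85), the identity (99)∕(100), and (92)∕(88) for the record -/

section BlockAverages

variable {𝔸 : Type*} [NormedRing 𝔸] [NormedAlgebra ℂ 𝔸] [CompleteSpace 𝔸]

/-- `wrecZ_succ`: (85) unfolded. [cite: Balaban1985Averaging, (85) p.31] -/
theorem wrecZ_succ (L : ℕ) (U₀ U₁ : SiteZ d → Fin d → 𝔸ˣ) (j : ℕ) (z : SiteZ d) :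
    wrecZ L U₀ U₁ (j + 1) z
      = savgZ L (fun x => tHol (avgIterZ L U₀ j) (tildIterZ L U₀ U₁ j) ((L : ℤ) • z) (treeWord (x - (L : ℤ) • z))
          * R0fun (avgIterZ L U₀ j) ((L : ℤ) • z) (wrecZ L U₀ U₁ j) x) ((L : ℤ) • z) := rfl

/-- **(85) at `j = 0` is (82)**: `w_1(x₁) = \overline{R_{0,x₁}U₁}` (`Ũ₁^0 = U₁`, `Ū₀^0 = U₀`, `w_0 = 1`), the block frame
`wframeZ L U₀ U₁` read on `Ω^{(1)}`. [cite: Balaban1985Averaging, (85) p.31, (82) p.30] -/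
theorem wrecZ_one (L : ℕ) (U₀ U₁ : SiteZ d → Fin d → 𝔸ˣ) (z : SiteZ d) :
    wrecZ L U₀ U₁ 1 z = wframeZ L U₀ U₁ ((L : ℤ) • z) := by
  rw [wrecZ_succ, avgIterZ_zero, tildIter_zero']
  have h : (fun x => tHol U₀ U₁ ((L : ℤ) • z) (treeWord (x - (L : ℤ) • z))
      * R0fun U₀ ((L : ℤ) • z) (wrecZ L U₀ U₁ 0) x)
      = fun x => tHol U₀ U₁ ((L : ℤ) • z) (treeWord (x - (L : ℤ) • z)) := by
    funext x
    simp only [wrecZ_zero, R0fun_apply, map_one, mul_one]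
  rw [h, savgZ_tHol]

/-- **(99)/(100)** p. 32: "\overline{R_{0,x}U₁^{(j)}} = v_j(x), x ∈ Ω^{(j)}. (99) For j = 1 it is the definition (97) of v_j.
For j + 1 we have by (85), (97), and (99) \overline{R_{0,y}U₁^{(j+1)}} = {(R̄^j_{0,y}Ũ₁^j)(Γ_{y,x})(R̄^j_{0,y}\overline{R_{0,x}U₁^{(j)}})(x)}_{x∈B(y)}
= {(R̄^j_{0,y}(U̿₁^j)^{v_j})(Γ_{y,x})(R̄^j_{0,y}v_j)(x)}_{x∈B(y)} = v_j(y)(\overline{R̄^j_{0,y}U̿₁^j}) = v_{j+1}(y), y ∈ Ω^{(j+1)}, (100)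
hence the identity (99) is proved by induction." — the recursively defined block averages (85) ARE the accumulated
frames (97), for every `j` (here from `j = 0`, `w_0 = v_0 = 1`). Inputs, as printed: the fundamental equality (97)
(`B7Eq92Concrete.B7Eq92ConcreteRec.tildIterZ_eq_mgauge`), the transporter covariance (`tHol_mgauge`, via `tHol_mgauge_mul_R0fun`) and the
left-invariance of the site average (`savgZ_const_mul`). [cite: Balaban1985Averaging, (99) p.32, (100) p.32] -/
theorem wrecZ_eq_vcovZ (L : ℕ) (U₀ U₁ : SiteZ d → Fin d → 𝔸ˣ) : ∀ j : ℕ, wrecZ L U₀ U₁ j = vcovZ L U₀ U₁ j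
  | 0 => rfl
  | j + 1 => by
    funext z
    rw [wrecZ_succ, wrecZ_eq_vcovZ L U₀ U₁ j, B7Eq92ConcreteRec.tildIterZ_eq_mgauge L U₀ U₁ j, B7SectCDGaugeAveragesRec.vcovZ_succ]
    have h : (fun x => tHol (avgIterZ L U₀ j)
          (mgauge (avgIterZ L U₀ j) (vcovZ L U₀ U₁ j) (dbavgCovIterZ L U₀ U₁ j)) ((L : ℤ) • z)
          (treeWord (x - (L : ℤ) • z)) * R0fun (avgIterZ L U₀ j) ((L : ℤ) • z) (vcovZ L U₀ U₁ j) x)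
        = fun x => vcovZ L U₀ U₁ j ((L : ℤ) • z)
          * tHol (avgIterZ L U₀ j) (dbavgCovIterZ L U₀ U₁ j) ((L : ℤ) • z) (treeWord (x - (L : ℤ) • z)) := by
      funext x
      exact tHol_mgauge_mul_R0fun _ _ _ _ _
    rw [h, savgZ_const_mul, savgZ_tHol]

/-- **(100), last two equalities**, as the one-step statement: for ANY frame `v` and configuration `W` at the background `V₀`,
`{(R_{0,y}W^v)(Γ_{y,x})(R_{0,y}v)(x)}_{x∈B(y)} = v(y)·\overline{R_{0,y}W}` (the abstract `B7Transfer.step99` for B7's own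
site average and transport, binders `hT`, `hb` discharged). [cite: Balaban1985Averaging, (100) p.32] -/
theorem step100Z (L : ℕ) (V₀ W : SiteZ d → Fin d → 𝔸ˣ) (v : SiteZ d → 𝔸ˣ) (y : SiteZ d) :
    savgZ L (fun x => tHol V₀ (mgauge V₀ v W) y (treeWord (x - y)) * R0fun V₀ y v x) y = v y * wframeZ L V₀ W y := by
  have h : (fun x => tHol V₀ (mgauge V₀ v W) y (treeWord (x - y)) * R0fun V₀ y v x)
      = fun x => v y * tHol V₀ W y (treeWord (x - y)) := funext fun x => tHol_mgauge_mul_R0fun _ _ _ _ _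
  rw [h, savgZ_const_mul, savgZ_tHol]

/-- **THE FUNDAMENTAL EQUALITY (92) PROPER** p. 31: "(\overline{R_{0,b₋}U₁^{(k)}})⁻¹Ũ₁^kR̄^k_{0,b}\overline{R_{0,b₊}U₁^{(k)}} = (U̿₁^k)_b. (92)"
— with the frames the recursively defined BLOCK AVERAGES (85) (print p. 32: "From (97), (99) for j = k we get (92)"), for
every `k`, every `L`, all unit-valued `U₀`, `U₁`, at every bond `b = ⟨z, z + e_κ⟩` of `Ω^{(k)} ≅ ℤ^d`
(`R̄^k_{0,b} = R(Ū₀^k(b))`). [cite: Balaban1985Averaging, (92) p.31, (97) p.32, (99) p.32] -/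
theorem eq92Z (L : ℕ) (U₀ U₁ : SiteZ d → Fin d → 𝔸ˣ) (k : ℕ) (z : SiteZ d) (κ : Fin d) :
    (wrecZ L U₀ U₁ k z)⁻¹ * tildIterZ L U₀ U₁ k z κ
        * Rc (avgIterZ L U₀ k z κ) (wrecZ L U₀ U₁ k (z + e κ))
      = dbavgCovIterZ L U₀ U₁ k z κ := by
  rw [wrecZ_eq_vcovZ, B7Eq92ConcreteRec.tildIterZ_eq_mgauge L U₀ U₁ k, mgauge_apply]
  group

/-- (92) in the gauge-action form: `Ũ₁^k = (U̿₁^k)^{w_k}` with `w_k = \overline{R_{0,·}U₁^{(k)}}` the block averages (85).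
[cite: Balaban1985Averaging, (92) p.31, (99) p.32] -/
theorem tildIterZ_eq_mgauge_wrecZ (L : ℕ) (U₀ U₁ : SiteZ d → Fin d → 𝔸ˣ) (k : ℕ) :
    tildIterZ L U₀ U₁ k = mgauge (avgIterZ L U₀ k) (wrecZ L U₀ U₁ k) (dbavgCovIterZ L U₀ U₁ k) := by
  rw [wrecZ_eq_vcovZ, B7Eq92ConcreteRec.tildIterZ_eq_mgauge]

/-- **(87) ⇒ (88) = `U̿₁^k`** p. 31: "u(y) = (\overline{R_{0,y}U₁^{(k)}})⁻¹. (87) … Similarly as in (63) we get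
Ū^k_b(Ū₀^k)_b⁻¹ = (\overline{U′U₀}^k)_b(Ū₀^k)_b⁻¹ = u(b₋)(\overline{U₁U₀}^k)_b(Ū₀^k)_b⁻¹R̄^k_{0,b}u⁻¹(b₊) =
(\overline{R_{0,b₋}U₁^{(k)}})⁻¹Ũ₁^kR̄^k_{0,b}\overline{R_{0,b₊}U₁^{(k)}}, b ⊂ Ω^{(k)}. (88)" combined with (92): for the
gauge-fixed field `U′ = U₁^u` (moving frame (55) at `U₀`), IF the gauge function read at level `k` (`u_k(z) = u(L^kz)`,
`uLev`) is given by (87) — the HYPOTHESIS `h87`; the gauge-fixing conditions (81)/(84)/(86) producing it are not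
formalised — then `(\overline{U′U₀})^k(Ū₀^k)⁻¹ = U̿₁^k` bondwise. The middle equality of (88) alone, for every `u`, is
`B7Eq92Concrete.B7Eq92ConcreteRec.tildIterZ_mgauge` ((70)/(71)). [cite: Balaban1985Averaging, (87) p.31, (88) p.31, (92) p.31] -/
theorem eq88_of_87Z (L : ℕ) (U₀ U₁ : SiteZ d → Fin d → 𝔸ˣ) (u : SiteZ d → 𝔸ˣ) (k : ℕ)
    (h87 : ∀ z : SiteZ d, uLev L u k z = (wrecZ L U₀ U₁ k z)⁻¹) :
    tildIterZ L U₀ (mgauge U₀ u U₁) k = dbavgCovIterZ L U₀ U₁ k := by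
  funext z κ
  rw [B7Eq92ConcreteRec.tildIterZ_mgauge, mgauge_apply, h87, h87, map_inv, inv_inv, tildIterZ_eq_mgauge_wrecZ, mgauge_apply]
  group

/-- (88)/(43) for the full average under (87): `(\overline{U′U₀})^k = U̿₁^k·Ū₀^k`, i.e. in the gauge (87) the `k`-fold
average of `U = U′U₀` is the double-bar average times the averaged background, with NO frame left over.
[cite: Balaban1985Averaging, (88) p.31, (43) p.23] -/
theorem avgIterZ_eq_of_87 (L : ℕ) (U₀ U₁ : SiteZ d → Fin d → 𝔸ˣ) (u : SiteZ d → 𝔸ˣ) (k : ℕ)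
    (h87 : ∀ z : SiteZ d, uLev L u k z = (wrecZ L U₀ U₁ k z)⁻¹) :
    avgIterZ L (mgauge U₀ u U₁ * U₀) k = dbavgCovIterZ L U₀ U₁ k * avgIterZ L U₀ k := by
  have h := eq88_of_87Z L U₀ U₁ u k h87
  funext z κ
  have hz := congrFun (congrFun h z) κ
  rw [tildIterZ_apply] at hz
  rw [Pi.mul_apply, Pi.mul_apply, ← hz, inv_mul_cancel_right]

end BlockAverages

end Literature.MathematicalPhysics.QuantumFieldTheory.Balaban1983to89.B7Eq99ConcreteRec
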